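import Summits.Ventures.PercRepro.Night2HighCells
import Summits.Ventures.PercRepro.Night2LineHitCells

/-!
# night-2: THE NON-FAT CASE OF (FAIR) FOR `|W| ≥ 12` — h21's cell `(2, 1)` holds for every `|G| ≥ 18` (gen 39)

Every lossy basis pair of the non-fat cell `(2, 1)` with `N = |W| ≥ 12` is fair:
* if some line through two points of `W` carries `≥ 9` of them, the hitting line theorem (`basis_pair_fair_of_nine_collinear`,
  `|W ∖ ℓ| ≤ 28`) or, beyond `N ≥ 38`, gen 38's large-`G` theorem;
* otherwise every line carries `≤ 8` points of `W` and for `N ≥ 15` the high-level theorem applies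
  (`basis_pair_fair_of_lines_le_eight`);
* for `12 ≤ N ≤ 14` the longest line has `d = N − 6 … 8` points (the small line cells `(d, N − d)`) or every line has
  `≤ N − 7` points (the small high-level cells `(N, N − 7)`).
**`basis_pair_fair_of_twelve`**, **`localShadowHall_nonfat_of_eighteen`**, **`localShadowHall_two_one_of_eighteen`**:
h21's cell `(2, 1)` for every `|G| ≥ 18` (gen 38: `|G| ≥ 44`).  The non-fat case of (FAIR) is thereby reduced to
`11 ≤ |G| ≤ 17`.  Paper: proofs/NIGHT-2-g39.md §5.
-/

namespace PercRepro.Shadow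

open PercRepro.ThmH PercRepro.PerFlat

variable {α : Type*} [DecidableEq α] {M : Matroid α} [M.Finite] {G : Finset α}

/-- The points of `W` are off the coloops. -/
theorem mem_sdiff_coloops_of_mem_sdiff_insert (hG : G ∈ flatsQ M (5 + 1)) (hd : (gr M \ G).card = 2)
    {B : Finset α} (hB : B ∈ thinMembers M 5 G) {z x : α} (hx : x ∈ G \ insert z B) : x ∈ G \ coloops M G := by
  have hd' : (gr M \ G).card ≤ 5 := by omega
  have hKB : coloops M G ⊆ B := coloops_subset_of_mem_thinMembers hG hd' hB
  exact Finset.mem_sdiff.2 ⟨(Finset.mem_sdiff.1 hx).1,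
    fun h => (Finset.mem_sdiff.1 hx).2 (Finset.mem_insert_of_mem (hKB h))⟩

/-- **`|W| ≥ 15` ⇒ fair.** -/
theorem basis_pair_fair_of_fifteen (hG : G ∈ flatsQ M (5 + 1)) (hd : (gr M \ G).card = 2)
    (hk : kColoops M G = 1) (hs : ∀ e ∈ gr M, ∀ f ∈ gr M, e ≠ f → rkN M {e, f} = 2)
    (hl : ∀ e ∈ gr M, M.Indep {e}) (hnf : fatClosures M 5 G 2 = ∅) {B : Finset α}
    (hB : B ∈ thinMembers M 5 G) (hnP : ¬ bigP M G B) {z : α} (hz : z ∈ G \ clF M B)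
    (hl0 : loss M 5 G B z ≠ 0) (hN : 15 ≤ (G \ insert z B).card) :
    loss M 5 G B z ≤ rhoL M 5 G B z * lossIncomeH M 5 G (bigP M G) (dshGT2 M 5 G) B z := by
  by_cases h9 : ∃ x ∈ G \ insert z B, ∃ y ∈ G \ insert z B, x ≠ y ∧
      9 ≤ ((G \ insert z B) ∩ clF M {x, y}).card
  · obtain ⟨x, hx, y, hy, hxy, hd9⟩ := h9
    have hsplit := Finset.card_sdiff_add_card_inter (G \ insert z B) (clF M {x, y})
    rcases Nat.lt_or_ge ((G \ insert z B) \ clF M {x, y}).card 29 with hlt | hge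
    · exact basis_pair_fair_of_nine_collinear hG hd hk hs hl hnf hB hnP hz hl0
        (mem_sdiff_coloops_of_mem_sdiff_insert hG hd hB hx) (mem_sdiff_coloops_of_mem_sdiff_insert hG hd hB hy)
        hxy hd9 (by omega)
    · exact basis_pair_fair_of_large hG hd hk hs hl hnf hB hnP hz hl0 (by omega)
  · apply basis_pair_fair_of_lines_le_eight hG hd hk hs hl hnf hB hnP hz hl0 _ hN
    intro x hx y hy hxy
    by_contra h
    exact h9 ⟨x, hx, y, hy, hxy, by omega⟩

/-- **`12 ≤ |W| ≤ 14` ⇒ fair**: nine collinear points (the hitting line theorem), a longest line of `N − 6 … 8` points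
(the small line cells), or every line with `≤ N − 7` points (the small high-level cells). -/
theorem basis_pair_fair_of_twelve_fourteen (hG : G ∈ flatsQ M (5 + 1)) (hd : (gr M \ G).card = 2)
    (hk : kColoops M G = 1) (hs : ∀ e ∈ gr M, ∀ f ∈ gr M, e ≠ f → rkN M {e, f} = 2)
    (hl : ∀ e ∈ gr M, M.Indep {e}) (hnf : fatClosures M 5 G 2 = ∅) {B : Finset α}
    (hB : B ∈ thinMembers M 5 G) (hnP : ¬ bigP M G B) {z : α} (hz : z ∈ G \ clF M B)
    (hl0 : loss M 5 G B z ≠ 0) (h12 : 12 ≤ (G \ insert z B).card) (h14 : (G \ insert z B).card ≤ 14) :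
    loss M 5 G B z ≤ rhoL M 5 G B z * lossIncomeH M 5 G (bigP M G) (dshGT2 M 5 G) B z := by
  by_cases h9 : ∃ x ∈ G \ insert z B, ∃ y ∈ G \ insert z B, x ≠ y ∧
      9 ≤ ((G \ insert z B) ∩ clF M {x, y}).card
  · obtain ⟨x, hx, y, hy, hxy, hd9⟩ := h9
    have hsplit := Finset.card_sdiff_add_card_inter (G \ insert z B) (clF M {x, y})
    exact basis_pair_fair_of_nine_collinear hG hd hk hs hl hnf hB hnP hz hl0
      (mem_sdiff_coloops_of_mem_sdiff_insert hG hd hB hx) (mem_sdiff_coloops_of_mem_sdiff_insert hG hd hB hy)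
      hxy hd9 (by omega)
  · by_cases hmid : ∃ x ∈ G \ insert z B, ∃ y ∈ G \ insert z B, x ≠ y ∧
        (G \ insert z B).card - 6 ≤ ((G \ insert z B) ∩ clF M {x, y}).card
    · obtain ⟨x, hx, y, hy, hxy, hdm⟩ := hmid
      have hsplit := Finset.card_sdiff_add_card_inter (G \ insert z B) (clF M {x, y})
      have hlt9 : ((G \ insert z B) ∩ clF M {x, y}).card < 9 := by
        by_contra h
        exact h9 ⟨x, hx, y, hy, hxy, by omega⟩
      exact basis_pair_fair_of_line_cells hG hd hk hs hl hnf hB hnP hz hl0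
        (mem_sdiff_coloops_of_mem_sdiff_insert hG hd hB hx) (mem_sdiff_coloops_of_mem_sdiff_insert hG hd hB hy)
        hxy (by omega)
    · apply basis_pair_fair_of_lines_le_small hG hd hk hs hl hnf hB hnP hz hl0
        (L := (G \ insert z B).card - 7) (by omega) ?_ (by omega)
      intro x hx y hy hxy
      by_contra h
      exact hmid ⟨x, hx, y, hy, hxy, by omega⟩

/-- **`|W| ≥ 12` ⇒ fair.** -/
theorem basis_pair_fair_of_twelve (hG : G ∈ flatsQ M (5 + 1)) (hd : (gr M \ G).card = 2)
    (hk : kColoops M G = 1) (hs : ∀ e ∈ gr M, ∀ f ∈ gr M, e ≠ f → rkN M {e, f} = 2)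
    (hl : ∀ e ∈ gr M, M.Indep {e}) (hnf : fatClosures M 5 G 2 = ∅) {B : Finset α}
    (hB : B ∈ thinMembers M 5 G) (hnP : ¬ bigP M G B) {z : α} (hz : z ∈ G \ clF M B)
    (hl0 : loss M 5 G B z ≠ 0) (h12 : 12 ≤ (G \ insert z B).card) :
    loss M 5 G B z ≤ rhoL M 5 G B z * lossIncomeH M 5 G (bigP M G) (dshGT2 M 5 G) B z := by
  rcases Nat.lt_or_ge (G \ insert z B).card 15 with h | h
  · exact basis_pair_fair_of_twelve_fourteen hG hd hk hs hl hnf hB hnP hz hl0 h12 (by omega)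
  · exact basis_pair_fair_of_fifteen hG hd hk hs hl hnf hB hnP hz hl0 h

/-- **The cell `(2, 1)` with no fat closure satisfies the local Hall inequality for `|G| ≥ 18`.** -/
theorem localShadowHall_nonfat_of_eighteen (hG : G ∈ flatsQ M (5 + 1)) (hd : (gr M \ G).card = 2)
    (hk : kColoops M G = 1) (hs : ∀ e ∈ gr M, ∀ f ∈ gr M, e ≠ f → rkN M {e, f} = 2)
    (hl : ∀ e ∈ gr M, M.Indep {e}) (hnf : fatClosures M 5 G 2 = ∅) (h18 : 18 ≤ G.card) :
    LocalShadowHall M 5 G := by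
  have hfat : (fatClosures M 5 G 2).card ≤ 1 := by
    rw [hnf, Finset.card_empty]
    exact zero_le_one
  apply localShadowHall_of_gt2_of_basis_fair hG hd hk hs hl hfat
  intro B hB hnP z hz
  by_cases hl0 : loss M 5 G B z = 0
  · rw [hl0]
    have hd' : (gr M \ G).card ≤ 5 := by omega
    have h1 : 0 ≤ rhoL M 5 G B z := by
      unfold rhoL
      rw [hl0]
      simp
    have h2 : 0 ≤ lossIncomeH M 5 G (bigP M G) (dshGT2 M 5 G) B z :=
      lossIncomeH_nonneg hG hd' (column_side_gt2 hG hd hk hs hl hfat) B z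
    positivity
  · apply basis_pair_fair_of_twelve hG hd hk hs hl hnf hB hnP hz hl0
    rw [card_sdiff_insert_eq_card_sub_six hG hd hk hB hnP hz]
    omega

/-- **h21's cell `(2, 1)` for every `|G| ≥ 18`**: at least two fat closures (gen 28), exactly one (gen 36), or none
(`localShadowHall_nonfat_of_eighteen`). -/
theorem localShadowHall_two_one_of_eighteen (hG : G ∈ flatsQ M (5 + 1)) (hd : (gr M \ G).card = 2)
    (hk : kColoops M G = 1) (hs : ∀ e ∈ gr M, ∀ f ∈ gr M, e ≠ f → rkN M {e, f} = 2)
    (hl : ∀ e ∈ gr M, M.Indep {e}) (h18 : 18 ≤ G.card) : LocalShadowHall M 5 G := by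
  rcases Nat.lt_or_ge (fatClosures M 5 G 2).card 2 with hlt | hge
  · rcases Nat.lt_or_ge (fatClosures M 5 G 2).card 1 with h0 | h1
    · have hnf : fatClosures M 5 G 2 = ∅ := Finset.card_eq_zero.1 (by omega)
      exact localShadowHall_nonfat_of_eighteen hG hd hk hs hl hnf h18
    · obtain ⟨B₀, hB₀, hm₀⟩ := exists_fat_member_of_card_eq_one hG hd (by omega)
      exact localShadowHall_fat hG hd hk hs hl (by omega) hB₀ hm₀
  · exact localShadowHall_two_one_five_fatClosures_free hG hd hk hs hl hge

end PercRepro.Shadow
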